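import Summits.QuantumAdvantage.QuantumAdvantage.Theorems.CubicForrelationNearExactIsExactCubicFormFibreAffine

/-!
# Crux `CubicForrelation.NearExactIsExact` (stmt-QuantumAdvantage-14043) — the `h = 0` TYPES of a `T`-cell: `wt < 128 ⇒ β_UF = 0`
  (type (0,0)), `wt < 192 ⇒ rank β_UF ≤ 1` (type (0,0) or (0,1))

Certificate seat `b2b-cforr-cert` (gen 41).  HONEST FRAMING: kernel-checked counting (standard axioms) on top of …CubicFormFibreAffine
(`tfa_T_menu_h0`, `tfa_affine_closed_card`): for a cell `f = y₀y₁y₂ ⊕ Q` on `3 + 6` bits with affine fibres (`β_FF = 0`), the mixed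
form `β_UF(a, x) = Q(a,x) ⊕ Q(a,0) ⊕ Q(0,x) ⊕ Q(0,0)` is additive in `a`, the constant fibres form a coset of its kernel, and the weight
bounds of `tfa_T_menu_h0` give: `#f < 128 ⇒ β_UF ≡ 0` and `#f < 192 ⇒` all rows `β_UF(a, ·)` lie in `{0, m}` for one `m` (rank `≤ 1`) —
the types `(0,0)`, `(0,1)` of cell lemma L-T (HOME/b2b-cforr-cert-g39/E1280-HANDPROOFS.md App. A.3: `M(0,1) ≥ 128`, `M(0,≥2) ≥ 192`).
Nothing about `θ₁₂`; NOT summit progress.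

* `tft_T_types_h0`: the two implications.
* `tft_T_weight_ge`: all fibres affine ⇒ `64 ≤ wt f`.

References: E1280-HANDPROOFS.md App. A.3.  Axioms: the standard three.
-/

set_option linter.dupNamespace false -- D-0017: single-problem summit ⇒ `QuantumAdvantage.QuantumAdvantage` by design

namespace Summit.QuantumAdvantage.QuantumAdvantage.Theorems.CubicForrelation.NearExactIsExact

open Finset
open Literature.Computability.QuantumComplexity.BuzetChailloux (bxor zeroVec allOnes bxor_comm bxor_self bxor_zeroVec zeroVec_bxor
  bxor_bxor_cancel_left)

/-- **Types `(0,0)` / `(0,1)` of a `T`-cell with affine fibres.**  See the module docstring. [this work] -/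
theorem tft_T_types_h0 (f : (Fin (3 + 6) → Bool) → Bool)
    (hT : ∀ u v w x : Fin (3 + 6) → Bool,
      (((f x ^^ f (bxor x w)) ^^ (f (bxor x v) ^^ f (bxor (bxor x v) w))) ^^
          ((f (bxor x u) ^^ f (bxor (bxor x u) w)) ^^ (f (bxor (bxor x u) v) ^^ f (bxor (bxor (bxor x u) v) w)))) =
        ((((u (Fin.castAdd 6 0) && (v (Fin.castAdd 6 1) && w (Fin.castAdd 6 2))) ^^
              (u (Fin.castAdd 6 0) && (v (Fin.castAdd 6 2) && w (Fin.castAdd 6 1)))) ^^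
            ((u (Fin.castAdd 6 1) && (v (Fin.castAdd 6 0) && w (Fin.castAdd 6 2))) ^^
              (u (Fin.castAdd 6 1) && (v (Fin.castAdd 6 2) && w (Fin.castAdd 6 0))))) ^^
          ((u (Fin.castAdd 6 2) && (v (Fin.castAdd 6 0) && w (Fin.castAdd 6 1))) ^^
            (u (Fin.castAdd 6 2) && (v (Fin.castAdd 6 1) && w (Fin.castAdd 6 0))))))
    (hFF : ∀ (t : Fin 3 → Bool) (v w x : Fin 6 → Bool),
      let Qt : (Fin 6 → Bool) → Bool := fun s =>
        f (Fin.append t s) ^^ (((Fin.append t s) (Fin.castAdd 6 0) && (Fin.append t s) (Fin.castAdd 6 1)) && (Fin.append t s) (Fin.castAdd 6 2))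
      ((Qt x ^^ Qt (bxor x w)) ^^ (Qt (bxor x v) ^^ Qt (bxor (bxor x v) w))) = false) :
    let Qf : (Fin 3 → Bool) → (Fin 6 → Bool) → Bool := fun t s =>
      f (Fin.append t s) ^^ (((Fin.append t s) (Fin.castAdd 6 0) && (Fin.append t s) (Fin.castAdd 6 1)) && (Fin.append t s) (Fin.castAdd 6 2))
    let βUF : (Fin 3 → Bool) → (Fin 6 → Bool) → Bool := fun a x => (Qf a x ^^ Qf a zeroVec) ^^ (Qf zeroVec x ^^ Qf zeroVec zeroVec)
    (#(univ.filter fun y : Fin (3 + 6) → Bool => f y = true) < 128 → ∀ a x, βUF a x = false) ∧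
    (#(univ.filter fun y : Fin (3 + 6) → Bool => f y = true) < 192 →
      ∃ m : (Fin 6 → Bool) → Bool, ∀ a, (∀ x, βUF a x = false) ∨ (∀ x, βUF a x = m x)) := by
  classical
  intro Qf βUF
  obtain ⟨hN, hN4⟩ := tfa_T_menu_h0 f hT hFF
  -- `ℓ_{t ⊕ a} = ℓ_t ⊕ ℓ_a ⊕ ℓ_0` (the cubic form vanishes on mixed triples with one pure-`F` argument)
  have hℓ : ∀ (t a : Fin 3 → Bool) (s : Fin 6 → Bool), (Qf (bxor t a) s ^^ Qf (bxor t a) zeroVec) =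
      ((Qf t s ^^ Qf t zeroVec) ^^ (Qf a s ^^ Qf a zeroVec) ^^ (Qf zeroVec s ^^ Qf zeroVec zeroVec)) := by
    intro t a s
    have e := hT (Fin.append t zeroVec) (Fin.append a zeroVec) (Fin.append zeroVec s)
      (Fin.append (zeroVec : Fin 3 → Bool) (zeroVec : Fin 6 → Bool))
    have hz3 : ∀ k, (zeroVec : Fin 3 → Bool) k = false := fun k => rfl
    simp only [tcc_append_bxor, bxor_zeroVec, zeroVec_bxor, Fin.append_left, hz3, Bool.and_false, Bool.xor_false] at e
    simp only [Qf, Fin.append_left]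
    revert e
    generalize f (Fin.append (bxor t a) s) = A₁
    generalize f (Fin.append (bxor t a) zeroVec) = A₂
    generalize f (Fin.append t s) = A₃
    generalize f (Fin.append t zeroVec) = A₄
    generalize f (Fin.append a s) = A₅
    generalize f (Fin.append a zeroVec) = A₆
    generalize f (Fin.append zeroVec s) = A₇
    generalize f (Fin.append zeroVec zeroVec) = A₈
    generalize ((bxor t a 0 && bxor t a 1) && bxor t a 2) = M₁
    generalize ((t 0 && t 1) && t 2) = M₂
    generalize ((a 0 && a 1) && a 2) = M₃
    simp only [hz3, Bool.false_and, Bool.xor_false]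
    revert A₁ A₂ A₃ A₄ A₅ A₆ A₇ A₈ M₁ M₂ M₃
    decide
  -- `βUF` is additive in `a`; the constant fibres
  have hβadd : ∀ a a' x, βUF (bxor a a') x = (βUF a x ^^ βUF a' x) := by
    intro a a' x
    simp only [βUF]
    rw [hℓ a a' x]
    generalize (Qf a x ^^ Qf a zeroVec) = p; generalize (Qf a' x ^^ Qf a' zeroVec) = q
    generalize (Qf zeroVec x ^^ Qf zeroVec zeroVec) = r
    revert p q r; decide
  set Z := univ.filter fun t : Fin 3 → Bool => ¬ ∃ s, Qf t s ≠ Qf t zeroVec with hZdef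
  set N := #(univ.filter fun t : Fin 3 → Bool => ∃ s, Qf t s ≠ Qf t zeroVec) with hNdef
  have hZN : #Z + N = 8 := by
    have e := card_filter_add_card_filter_not (s := (univ : Finset (Fin 3 → Bool))) (fun t => ∃ s, Qf t s ≠ Qf t zeroVec)
    rw [card_univ, Fintype.card_fun, Fintype.card_bool, Fintype.card_fin] at e
    change N + #Z = 2 ^ 3 at e
    omega
  have hZmem : ∀ t, t ∈ Z ↔ ∀ s, Qf t s = Qf t zeroVec := by
    intro t; rw [hZdef, mem_filter]; simp only [mem_univ, true_and]; push Not; rfl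
  -- `βUF a = ℓ_a ⊕ ℓ_0`; on `Z × Z` differences are in the kernel
  have hker : ∀ z ∈ Z, ∀ z' ∈ Z, ∀ x, βUF (bxor z z') x = false := by
    intro z hz z' hz' x
    rw [hβadd]
    simp only [βUF]
    rw [(hZmem z).1 hz x, (hZmem z').1 hz' x]
    simp only [Bool.xor_self, Bool.false_xor]
  refine ⟨fun h128 => ?_, fun h192 => ?_⟩
  · -- `N ≤ 3 ⇒ N = 0 ⇒ Z = univ ⇒ βUF ≡ 0`
    have hN0 : N = 0 := by rcases hN4 with h0 | h4 <;> omega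
    have hZu : ∀ t, t ∈ Z := by
      have : Z = univ := Finset.eq_univ_of_card Z (by rw [Fintype.card_fun, Fintype.card_bool, Fintype.card_fin]; omega)
      intro t; rw [this]; exact mem_univ t
    intro a x
    have e := hker a (hZu a) zeroVec (hZu zeroVec) x
    rwa [bxor_zeroVec] at e
  · -- `N ≤ 5 ⇒ #Z ≥ 3 ⇒ #Z ∈ {4, 8}`; the kernel `K ⊇ Z ⊕ Z` has ≥ 4 elements
    have hZ3 : 3 ≤ #Z := by omega
    obtain ⟨z₀, hz₀⟩ : Z.Nonempty := by rw [← card_pos]; omega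
    set K := univ.filter fun a : Fin 3 → Bool => ∀ x, βUF a x = false with hKdef
    have hKmem : ∀ a, a ∈ K ↔ ∀ x, βUF a x = false := fun a => by rw [hKdef, mem_filter]; simp
    have hK4 : 3 ≤ #K := by
      have hsub : Z.image (fun z => bxor z₀ z) ⊆ K := by
        intro a ha
        obtain ⟨z, hz, rfl⟩ := mem_image.1 ha
        exact (hKmem _).2 (hker z₀ hz₀ z hz)
      have hinj : Function.Injective (fun z : Fin 3 → Bool => bxor z₀ z) := fun a b hab => by
        have e := congrArg (bxor z₀) hab; simp only [bxor_bxor_cancel_left] at e; exact e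
      have := card_le_card hsub
      rw [card_image_of_injective _ hinj] at this
      omega
    have hKcl : ∀ a ∈ K, ∀ b ∈ K, ∀ c ∈ K, bxor a (bxor b c) ∈ K := by
      intro a ha b hb c hc
      refine (hKmem _).2 fun x => ?_
      rw [hβadd, hβadd, (hKmem a).1 ha x, (hKmem b).1 hb x, (hKmem c).1 hc x]; rfl
    rcases tfa_affine_closed_card K hKcl with hKu | hK4'
    · refine ⟨fun _ => false, fun a => Or.inl ((hKmem a).1 (by rw [hKu]; exact mem_univ a))⟩
    · -- `#K = 3` is impossible (xor-closed), so `#K = 4`: rows outside `K` are all equal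
      have hK0 : zeroVec ∈ K := (hKmem _).2 fun x => by
        have e := hβadd zeroVec zeroVec x; rw [bxor_self] at e
        revert e; cases βUF zeroVec x <;> decide
      have hKadd : ∀ a ∈ K, ∀ b ∈ K, bxor a b ∈ K := fun a ha b hb => by
        have := hKcl a ha b hb zeroVec hK0; rwa [bxor_zeroVec] at this
      by_cases hall : ∀ a, a ∈ K
      · exact ⟨fun _ => false, fun a => Or.inl ((hKmem a).1 (hall a))⟩
      · push Not at hall
        obtain ⟨a₀, ha₀⟩ := hall
        refine ⟨fun x => βUF a₀ x, fun a => ?_⟩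
        by_cases ha : a ∈ K
        · exact Or.inl ((hKmem a).1 ha)
        · right
          -- `a ⊕ a₀ ∈ K`: the coset `a₀ ⊕ K` is the complement of `K` (both have `≥ 3` of the `8 − #K ≤ 5`... count)
          have hcos : bxor a a₀ ∈ K := by
            by_contra hnot
            -- `K`, `a₀ ⊕ K`, and `a ⊕ a₀`... : the translates `a₀ ⊕ K` and `a ⊕ K` are disjoint from `K`; if `a ⊕ a₀ ∉ K` they are
            -- also disjoint from each other, giving `3 #K ≤ 8`, contradiction with `#K ≥ 3`.
            have hd1 : Disjoint (K.image (bxor a₀)) K := by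
              rw [disjoint_left]; intro y hy hyK
              obtain ⟨k, hk, rfl⟩ := mem_image.1 hy
              exact ha₀ (by have := hKadd _ hyK _ hk; rwa [iw_bxor_assoc, bxor_self, bxor_zeroVec] at this)
            have hd2 : Disjoint (K.image (bxor a)) K := by
              rw [disjoint_left]; intro y hy hyK
              obtain ⟨k, hk, rfl⟩ := mem_image.1 hy
              exact ha (by have := hKadd _ hyK _ hk; rwa [iw_bxor_assoc, bxor_self, bxor_zeroVec] at this)
            have hd3 : Disjoint (K.image (bxor a₀)) (K.image (bxor a)) := by
              rw [disjoint_left]; intro y hy hy'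
              obtain ⟨k, hk, rfl⟩ := mem_image.1 hy
              obtain ⟨k', hk', e⟩ := mem_image.1 hy'
              apply hnot
              have : bxor a a₀ = bxor k k' := by
                -- from `a ⊕ k' = a₀ ⊕ k`, pointwise
                funext i
                have ei := congrFun e i
                simp only [bxor] at ei ⊢
                revert ei; cases a i <;> cases a₀ i <;> cases k i <;> cases k' i <;> decide
              rw [this]; exact hKadd _ hk _ hk'
            have hi1 : #(K.image (bxor a₀)) = #K := card_image_of_injective _ (fun p q h => by
              have e := congrArg (bxor a₀) h; simp only [bxor_bxor_cancel_left] at e; exact e)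
            have hi2 : #(K.image (bxor a)) = #K := card_image_of_injective _ (fun p q h => by
              have e := congrArg (bxor a) h; simp only [bxor_bxor_cancel_left] at e; exact e)
            have hu := card_le_univ ((K.image (bxor a₀) ∪ K.image (bxor a)) ∪ K)
            rw [card_union_of_disjoint (disjoint_union_left.2 ⟨hd1, hd2⟩), card_union_of_disjoint hd3, hi1, hi2,
              Fintype.card_fun, Fintype.card_bool, Fintype.card_fin] at hu
            omega
          intro x
          have e := hβadd (bxor a a₀) a₀ x
          rw [iw_bxor_assoc, bxor_self, bxor_zeroVec, (hKmem _).1 hcos x, Bool.false_xor] at e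
          exact e

/-- **A `T`-cell with affine fibres weighs at least `64`.**  If all fibres are affine (`β_FF = 0`), then `64 ≤ wt f`: either some fibre is
non-constant (then `wt ≥ 128` by `tfa_T_menu_h0`), or every fibre is constant, the weight is a sum of multiples of `64`, and `wt f = 0`
would make `f ≡ 0` near the origin, contradicting the cubic form `y₀y₁y₂`. [this work; E1280-HANDPROOFS App. A.3, `r̄ = 0`] -/
theorem tft_T_weight_ge (f : (Fin (3 + 6) → Bool) → Bool)
    (hT : ∀ u v w x : Fin (3 + 6) → Bool,
      (((f x ^^ f (bxor x w)) ^^ (f (bxor x v) ^^ f (bxor (bxor x v) w))) ^^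
          ((f (bxor x u) ^^ f (bxor (bxor x u) w)) ^^ (f (bxor (bxor x u) v) ^^ f (bxor (bxor (bxor x u) v) w)))) =
        ((((u (Fin.castAdd 6 0) && (v (Fin.castAdd 6 1) && w (Fin.castAdd 6 2))) ^^
              (u (Fin.castAdd 6 0) && (v (Fin.castAdd 6 2) && w (Fin.castAdd 6 1)))) ^^
            ((u (Fin.castAdd 6 1) && (v (Fin.castAdd 6 0) && w (Fin.castAdd 6 2))) ^^
              (u (Fin.castAdd 6 1) && (v (Fin.castAdd 6 2) && w (Fin.castAdd 6 0))))) ^^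
          ((u (Fin.castAdd 6 2) && (v (Fin.castAdd 6 0) && w (Fin.castAdd 6 1))) ^^
            (u (Fin.castAdd 6 2) && (v (Fin.castAdd 6 1) && w (Fin.castAdd 6 0))))))
    (hFF : ∀ (t : Fin 3 → Bool) (v w x : Fin 6 → Bool),
      let Qt : (Fin 6 → Bool) → Bool := fun s =>
        f (Fin.append t s) ^^ (((Fin.append t s) (Fin.castAdd 6 0) && (Fin.append t s) (Fin.castAdd 6 1)) && (Fin.append t s) (Fin.castAdd 6 2))
      ((Qt x ^^ Qt (bxor x w)) ^^ (Qt (bxor x v) ^^ Qt (bxor (bxor x v) w))) = false) :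
    64 ≤ #(univ.filter fun y : Fin (3 + 6) → Bool => f y = true) := by
  classical
  obtain ⟨hN, hN4⟩ := tfa_T_menu_h0 f hT hFF
  rcases hN4 with hN0 | h4
  · -- every fibre is constant
    obtain ⟨-, hfib⟩ := tfb_fibre_formula f hT
    set Q : (Fin (3 + 6) → Bool) → Bool := fun z => f z ^^ ((z (Fin.castAdd 6 0) && z (Fin.castAdd 6 1)) && z (Fin.castAdd 6 2)) with hQ
    obtain ⟨w, hw⟩ : ∃ w : (Fin 3 → Bool) → ℕ, ∀ v, w v = #(univ.filter fun s : Fin 6 → Bool => Q (Fin.append v s) = true) :=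
      ⟨_, fun _ => rfl⟩
    have hfib' : #(univ.filter fun y : Fin (3 + 6) → Bool => f y = true) + w allOnes =
        (∑ v ∈ (univ : Finset (Fin 3 → Bool)).erase allOnes, w v) + 2 ^ 6 := by
      rw [hw, sum_congr rfl fun v _ => hw v]; exact hfib
    have hconst : ∀ (t : Fin 3 → Bool) (s : Fin 6 → Bool), Q (Fin.append t s) = Q (Fin.append t zeroVec) := by
      have e : #(univ.filter fun t : Fin 3 → Bool => ∃ s, Q (Fin.append t s) ≠ Q (Fin.append t zeroVec)) = 0 := hN0
      rw [card_eq_zero, filter_eq_empty_iff] at e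
      intro t s
      by_contra hne
      exact e (mem_univ t) ⟨s, hne⟩
    have hw64 : ∀ t, (w t = 0 ∧ Q (Fin.append t zeroVec) = false) ∨ (w t = 64 ∧ Q (Fin.append t zeroVec) = true) := by
      intro t
      cases h0 : Q (Fin.append t zeroVec)
      · left
        refine ⟨?_, rfl⟩
        rw [hw, filter_false_of_mem fun s _ => by rw [hconst t s, h0]; exact Bool.false_ne_true, card_empty]
      · right
        refine ⟨?_, rfl⟩
        rw [hw, filter_true_of_mem fun s _ => by rw [hconst t s, h0], card_univ, Fintype.card_fun, Fintype.card_bool,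
          Fintype.card_fin]; rfl
    by_contra hlt
    push Not at hlt
    simp only [Nat.reducePow] at hfib'
    -- `w 111 = 64` and every other `w v = 0`
    have h7 : w allOnes = 64 ∧ Q (Fin.append allOnes zeroVec) = true := by
      rcases hw64 allOnes with ⟨h0, -⟩ | h64
      · exfalso; omega
      · exact h64
    have hother : ∀ v, v ≠ allOnes → Q (Fin.append v zeroVec) = false := by
      intro v hv
      rcases hw64 v with ⟨-, h0⟩ | ⟨h64, -⟩
      · exact h0
      · exfalso
        have hle := single_le_sum (f := w) (fun u _ => Nat.zero_le _) (mem_erase.2 ⟨hv, mem_univ v⟩)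
        omega
    -- hence `f` vanishes at `(v, 0)` for every `v`
    have hf0 : ∀ v : Fin 3 → Bool, f (Fin.append v zeroVec) = false := by
      intro v
      by_cases hv : v = allOnes
      · subst hv
        have e := h7.2
        simp only [hQ, Fin.append_left, allOnes, Bool.and_self, Bool.xor_true] at e
        revert e; cases f (Fin.append allOnes zeroVec) <;> decide
      · have e := hother v hv
        simp only [hQ, Fin.append_left] at e
        have hm : ((v 0 && v 1) && v 2) = false := by
          cases h0 : v 0 <;> cases h1 : v 1 <;> cases h2 : v 2 <;> try rfl
          exfalso; apply hv; funext i
          fin_cases i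
          · exact h0
          · exact h1
          · exact h2
        rw [hm, Bool.xor_false] at e
        exact e
    -- but the cubic form at `(e₀, e₁, e₂; 0)` is `1`
    have e := hT (Fin.append (fun l : Fin 3 => decide (l = 0)) zeroVec) (Fin.append (fun l : Fin 3 => decide (l = 1)) zeroVec)
      (Fin.append (fun l : Fin 3 => decide (l = 2)) zeroVec) (Fin.append (zeroVec : Fin 3 → Bool) (zeroVec : Fin 6 → Bool))
    simp only [tcc_append_bxor, bxor_zeroVec, hf0, Fin.append_left, Bool.xor_false] at e
    revert e
    decide
  · omega

end Summit.QuantumAdvantage.QuantumAdvantage.Theorems.CubicForrelation.NearExactIsExact
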